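import Mathlib
import HarnessLib

/-!
# FLOOR-0 P2, ROAD-W toe-hold (L2) «thetaShape_of_weight»: the theta shape of a conjugate-inverse-stable triple with one
# entry of modulus `q^{-1/2}`
(ORGAN L2 of ROAD-W v1 239b1f58, step W3 SHAPE; desk F0P2-plan (g16) statement-first heads `WeightOneSatakeShape…` acbddafefcd2fe76
VERBATIM as (a)(b)(c); proof F0P3a-p06 (g14).)  Generic lemma (ROAD-W v1 239b1f58 W3 toe-hold), parked under `Theorems/` for
provenance-lint reasons (`lint.literature-cited-only`: no print locus); upstream candidate (multiset algebra over `ℂ`).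

Pure algebra of multisets of complex numbers.  Let `q > 1` and let `M` be a multiset of THREE non-zero complex numbers stable under
the involution `z ↦ (conj z)⁻¹` (the shape of the Satake parameter of a UNITARY unramified representation) containing an element of
modulus `q^{-1/2}` (a WEIGHT condition).  Then `M = {u·q^{1/2}, u·q^{-1/2}, w}` with `|u| = |w| = 1` — the Satake parameter of the
unramified constituent of `Ind(u|·|^{1/2}, u|·|^{-1/2}, w)`, the local theta type — and `u·q^{-1/2}` is the ONLY entry of modulus
`q^{-1/2}`.  `0 ∉ M` is needed (`(conj 0)⁻¹ = 0` in Mathlib: `{α, (conj α)⁻¹, 0}` is stable with no such shape); `1 < q` is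
load-bearing (at `q = 1`, `M = {1, I, −1}` is stable with no `{u, u, w}` shape).
* `inv_conj_eq_self_iff_norm_eq_one` (the involution fixes `w ≠ 0` iff `‖w‖ = 1`) · `norm_inv_conj` · STRUCTURE
  `exists_eq_triple_of_map_inv_conj_eq`: `M ∋ z₀`, `‖z₀‖ ≠ 1` ⇒ `M = {z₀, (conj z₀)⁻¹, w}`, `‖w‖ = 1` (the involution swaps `z₀` and
  `(conj z₀)⁻¹ ≠ z₀`, so as a MULTISET matter it fixes the third entry) · heads (a) `thetaShape_of_weight` (THE ORGAN), (b)
  `filter_norm_eq_of_thetaShape` (the weight-`q^{-1/2}` entry is unique), (c) `map_conj_inv_thetaShape` (converse bookkeeping).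
Model use: purity of `H¹` + the congruence relation force the unramified local components of the `H¹`-automorphic representations
of `U(2,1)` into theta shape (`F0/P2/ROAD-W.v1.F0P2-plan-g15.md` §2 W3).  THEOREMS ONLY; Mathlib + HarnessLib imports only.

Cell hodgecm-mathlib (D-0151), FLOOR 0, crux item H413 = stmt-HodgeConjecture-24833; LEAD T10-39 (3) ∕ T10-41 ∕ T10-44, desk words
18:14:33Z (α)–(ε), reader F0P2-ref1 r321; lane `--kind proof --supports stmt-HodgeConjecture-24833 --as helper`; touches no registry
and no served Line.  HC_CM is proved only modulo the printed citations until rung 0 closes; this file proves nothing about them.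
[folklore]
-/

set_option autoImplicit false
-- the mandated namespace repeats `HodgeConjecture.HodgeConjecture`, as in every `Theorems/*.lean` of this sub-problem
set_option linter.dupNamespace false

namespace Summit.HodgeConjecture.HodgeConjecture.Cruxes.H413.F0P2wThetaShapeOfWeight

open ComplexConjugate

/-- The involution `z ↦ (conj z)⁻¹` of `ℂˣ` fixes a non-zero complex number `w` iff `‖w‖ = 1`. [folklore] -/
theorem inv_conj_eq_self_iff_norm_eq_one {w : ℂ} (hw : w ≠ 0) : (conj w)⁻¹ = w ↔ ‖w‖ = 1 := by
  constructor
  · intro h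
    have hcw : conj w ≠ 0 := (map_ne_zero (starRingEnd ℂ)).mpr hw
    have h1 : w * conj w = 1 := by
      calc w * conj w = (conj w)⁻¹ * conj w := by rw [h]
        _ = 1 := inv_mul_cancel₀ hcw
    have h2 : (‖w‖ : ℝ) ^ 2 = 1 := by rw [Complex.mul_conj'] at h1; exact_mod_cast h1
    nlinarith [norm_nonneg w, h2]
  · intro h
    rw [← Complex.inv_eq_conj h, inv_inv]

/-- The involution inverts the modulus: `‖(conj z)⁻¹‖ = ‖z‖⁻¹`. [folklore] -/
theorem norm_inv_conj (z : ℂ) : ‖(conj z)⁻¹‖ = ‖z‖⁻¹ := by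
  rw [norm_inv, Complex.norm_conj]

/-- `1 < q ⇒ 1 < √q`. [folklore] -/
theorem one_lt_sqrt {q : ℝ} (hq : 1 < q) : 1 < Real.sqrt q := by
  rw [show (1 : ℝ) = Real.sqrt 1 from Real.sqrt_one.symm]
  exact Real.sqrt_lt_sqrt (by norm_num) hq

/-- **Structure of a stable triple with an entry off the unit circle.**  `M` a multiset of three non-zero complex numbers, stable
under `z ↦ (conj z)⁻¹`, `z₀ ∈ M` with `‖z₀‖ ≠ 1` ⇒ `M = {z₀, (conj z₀)⁻¹, w}` with `‖w‖ = 1`: `(conj z₀)⁻¹ ∈ M` has modulus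
`‖z₀‖⁻¹ ≠ ‖z₀‖`, so these are two distinct members, and stability `{(conj z₀)⁻¹, z₀, (conj w)⁻¹} = {z₀, (conj z₀)⁻¹, w}` forces
`(conj w)⁻¹ = w`. [folklore] -/
theorem exists_eq_triple_of_map_inv_conj_eq {M : Multiset ℂ} (hcard : Multiset.card M = 3) (h0 : (0 : ℂ) ∉ M)
    (hstab : M.map (fun z => (conj z)⁻¹) = M) {z₀ : ℂ} (hz₀ : z₀ ∈ M) (hnorm : ‖z₀‖ ≠ 1) :
    ∃ w : ℂ, ‖w‖ = 1 ∧ M = {z₀, (conj z₀)⁻¹, w} := by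
  set ι : ℂ → ℂ := fun z => (conj z)⁻¹ with hι
  have hιι : ∀ z, ι (ι z) = z := fun z => by simp [hι]
  have hz₁ : ι z₀ ∈ M := by  -- `ι z₀` is a second, distinct member of `M`
    rw [← hstab]
    exact Multiset.mem_map_of_mem _ hz₀
  have hz₀0 : z₀ ≠ 0 := fun h => h0 (h ▸ hz₀)
  have hne : ι z₀ ≠ z₀ := fun h => hnorm ((inv_conj_eq_self_iff_norm_eq_one hz₀0).mp h)
  obtain ⟨T, hT⟩ := Multiset.exists_cons_of_mem hz₀  -- peel off `z₀`, then `ι z₀`; one element `w` remains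
  have hz₁T : ι z₀ ∈ T := by
    rw [hT, Multiset.mem_cons] at hz₁
    exact hz₁.resolve_left hne
  obtain ⟨U, hU⟩ := Multiset.exists_cons_of_mem hz₁T
  have hUcard : Multiset.card U = 1 := by
    rw [hT, hU, Multiset.card_cons, Multiset.card_cons] at hcard
    omega
  obtain ⟨w, hw⟩ := Multiset.card_eq_one.mp hUcard
  have hM : M = z₀ ::ₘ ι z₀ ::ₘ {w} := by rw [hT, hU, hw]
  have hιw : ι w = w := by  -- stability forces `ι w = w`
    have h := hstab
    rw [hM] at h
    simp only [Multiset.map_cons, Multiset.map_singleton, hιι] at h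
    rwa [Multiset.cons_swap, Multiset.cons_inj_right, Multiset.cons_inj_right, Multiset.singleton_inj] at h
  have hw0 : w ≠ 0 := by
    rintro rfl
    exact h0 (by rw [hM]; simp)
  refine ⟨w, (inv_conj_eq_self_iff_norm_eq_one hw0).mp hιw, ?_⟩
  simpa only [Multiset.insert_eq_cons] using hM

/-! ## The three heads (desk texts (a)(b)(c)) -/
/-- **Theta shape from one weight** (head (a), THE ORGAN).  Let `1 < q` and let `M` be a multiset of three non-zero complex numbers,
stable under `z ↦ (conj z)⁻¹`, containing an element of modulus `(√q)⁻¹ = q^{-1/2}`.  Then `M = {u·√q, u·(√q)⁻¹, w}` with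
`‖u‖ = ‖w‖ = 1`. [folklore] -/
theorem thetaShape_of_weight {q : ℝ} (hq : 1 < q) {M : Multiset ℂ} (hcard : Multiset.card M = 3)
    (h0 : (0 : ℂ) ∉ M) (hstab : M.map (fun z => (conj z)⁻¹) = M)
    (hα : ∃ α ∈ M, ‖α‖ = (Real.sqrt q)⁻¹) :
    ∃ u w : ℂ, ‖u‖ = 1 ∧ ‖w‖ = 1 ∧
      M = {u * (Real.sqrt q : ℂ), u * (Real.sqrt q : ℂ)⁻¹, w} := by
  obtain ⟨α, hα, hαn⟩ := hα
  have hq0 : (0 : ℝ) ≤ q := by linarith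
  have hsq1 : 1 < Real.sqrt q := one_lt_sqrt hq
  have hsq0 : Real.sqrt q ≠ 0 := by positivity
  have hnorm : ‖α‖ ≠ 1 := by
    rw [hαn]
    exact ne_of_lt (inv_lt_one_of_one_lt₀ hsq1)
  obtain ⟨w, hw1, hM⟩ := exists_eq_triple_of_map_inv_conj_eq hcard h0 hstab hα hnorm
  refine ⟨α * (Real.sqrt q : ℂ), w, ?_, hw1, ?_⟩
  · rw [norm_mul, hαn, Complex.norm_real, Real.norm_of_nonneg (Real.sqrt_nonneg q), inv_mul_cancel₀ hsq0]
  · -- `(conj α)⁻¹ = α · q = (α √q) √q` and `α = (α √q) (√q)⁻¹`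
    have hsqC : (Real.sqrt q : ℂ) ≠ 0 := by exact_mod_cast hsq0
    have hconj : (conj α)⁻¹ = α * (Real.sqrt q : ℂ) * (Real.sqrt q : ℂ) := by
      apply inv_eq_of_mul_eq_one_right
      have hns : α * conj α = ((‖α‖ ^ 2 : ℝ) : ℂ) := by
        rw [Complex.mul_conj']
        norm_cast
      have hqC : (q : ℂ) ≠ 0 := by exact_mod_cast (ne_of_gt (by linarith : (0 : ℝ) < q))
      calc conj α * (α * (Real.sqrt q : ℂ) * (Real.sqrt q : ℂ))
          = (α * conj α) * ((Real.sqrt q * Real.sqrt q : ℝ) : ℂ) := by push_cast; ring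
        _ = ((‖α‖ ^ 2 : ℝ) : ℂ) * (q : ℂ) := by rw [hns, Real.mul_self_sqrt hq0]
        _ = 1 := by
          rw [hαn, inv_pow, Real.sq_sqrt hq0]
          push_cast
          exact inv_mul_cancel₀ hqC
    rw [hM, hconj, mul_assoc α (Real.sqrt q : ℂ) (Real.sqrt q : ℂ)⁻¹, mul_inv_cancel₀ hsqC, mul_one]
    simp only [Multiset.insert_eq_cons]
    exact Multiset.cons_swap _ _ _

/-- The three moduli of a theta shape: `‖u √q‖ = √q`, `‖u (√q)⁻¹‖ = (√q)⁻¹` (and `‖w‖ = 1`). [folklore] -/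
theorem norm_thetaShape_entries (q : ℝ) {u : ℂ} (hu : ‖u‖ = 1) :
    ‖u * (Real.sqrt q : ℂ)‖ = Real.sqrt q ∧ ‖u * (Real.sqrt q : ℂ)⁻¹‖ = (Real.sqrt q)⁻¹ := by
  have hq0 : (0 : ℝ) ≤ Real.sqrt q := Real.sqrt_nonneg q
  refine ⟨?_, ?_⟩
  · rw [norm_mul, hu, one_mul, Complex.norm_real, Real.norm_of_nonneg hq0]
  · rw [norm_mul, hu, one_mul, norm_inv, Complex.norm_real, Real.norm_of_nonneg hq0]

open scoped Classical in
/-- **In theta shape the entry of modulus `q^{-1/2}` is unique** (head (b)): filtering `{u·√q, u·(√q)⁻¹, w}` (`‖u‖ = ‖w‖ = 1`,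
`1 < q`) on `‖z‖ = (√q)⁻¹` leaves exactly `{u·(√q)⁻¹}` — the moduli are `√q > 1 > (√q)⁻¹` and `1`.  (This is what makes a
Frobenius element act as a scalar on the weight-one part in ROAD-W step W3.) [folklore] -/
theorem filter_norm_eq_of_thetaShape {q : ℝ} (hq : 1 < q) {u w : ℂ} (hu : ‖u‖ = 1) (hw : ‖w‖ = 1) :
    ({u * (Real.sqrt q : ℂ), u * (Real.sqrt q : ℂ)⁻¹, w} : Multiset ℂ).filter
        (fun z => ‖z‖ = (Real.sqrt q)⁻¹) = {u * (Real.sqrt q : ℂ)⁻¹} := by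
  have hsq1 : 1 < Real.sqrt q := one_lt_sqrt hq
  have hinv1 : (Real.sqrt q)⁻¹ < 1 := inv_lt_one_of_one_lt₀ hsq1
  obtain ⟨h1, h2⟩ := norm_thetaShape_entries q hu
  have hn1 : ¬ ‖u * (Real.sqrt q : ℂ)‖ = (Real.sqrt q)⁻¹ := by
    rw [h1]
    exact ne_of_gt (lt_trans hinv1 hsq1)
  have hn3 : ¬ ‖w‖ = (Real.sqrt q)⁻¹ := by
    rw [hw]
    exact ne_of_gt hinv1
  simp only [Multiset.insert_eq_cons]
  rw [Multiset.filter_cons_of_neg (p := fun z : ℂ => ‖z‖ = (Real.sqrt q)⁻¹) _ hn1,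
    Multiset.filter_cons_of_pos (p := fun z : ℂ => ‖z‖ = (Real.sqrt q)⁻¹) _ h2,
    Multiset.filter_singleton, if_neg hn3]
  rfl

/-- **The theta shape is itself conjugate-inverse stable** (head (c), converse bookkeeping): the involution swaps `u·√q` and
`u·(√q)⁻¹` and fixes `w`. [folklore] -/
theorem map_conj_inv_thetaShape {q : ℝ} (hq : 1 < q) {u w : ℂ} (hu : ‖u‖ = 1) (hw : ‖w‖ = 1) :
    ({u * (Real.sqrt q : ℂ), u * (Real.sqrt q : ℂ)⁻¹, w} : Multiset ℂ).map (fun z => (conj z)⁻¹)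
      = {u * (Real.sqrt q : ℂ), u * (Real.sqrt q : ℂ)⁻¹, w} := by
  have _hsq : Real.sqrt q ≠ 0 := (lt_trans zero_lt_one (one_lt_sqrt hq)).ne'  -- (`hq` is otherwise idle in (c))
  have hcu : (conj u)⁻¹ = u := by rw [← Complex.inv_eq_conj hu, inv_inv]
  have hcw : (conj w)⁻¹ = w := by rw [← Complex.inv_eq_conj hw, inv_inv]
  have e1 : (conj (u * (Real.sqrt q : ℂ)))⁻¹ = u * (Real.sqrt q : ℂ)⁻¹ := by
    rw [map_mul, Complex.conj_ofReal, mul_inv, hcu]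
  have e2 : (conj (u * (Real.sqrt q : ℂ)⁻¹))⁻¹ = u * (Real.sqrt q : ℂ) := by
    rw [map_mul, map_inv₀, Complex.conj_ofReal, mul_inv, inv_inv, hcu]
  simp only [Multiset.insert_eq_cons, Multiset.map_cons, Multiset.map_singleton, e1, e2, hcw]
  exact Multiset.cons_swap _ _ _

end Summit.HodgeConjecture.HodgeConjecture.Cruxes.H413.F0P2wThetaShapeOfWeight
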